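import Summits.BirchSwinnertonDyer.BirchSwinnertonDyer.Theorems.UniversalToricDescentTowerDescent
import Summits.BirchSwinnertonDyer.BirchSwinnertonDyer.Theorems.UniversalToricDescentCofiniteDivisiblePart
import HarnessLib

/-!
# Procyclic descent at a layer with FINITE LAYER INVARIANTS: `#H¹(H, A)[p^k]^{δ₁^{p^n}} ≤ #H¹(G_n, A)[p^k]` when `A^{G_n}` is
# finite and `A[p]` is finite (crux ♭T≤ stmt-BirchSwinnertonDyer-23042, line `sigmacongruence`, stub R3 `stub_localTorsionCountAtTame`,
# brick (D))

Width prover `bsd-wall-utd-p1-w2` g1 under lead `bsd-wall-utd-p1` g18 (`--supports stmt-BirchSwinnertonDyer-23042`, helper). THEOREMS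
ONLY (no definition, no named fact, no `sorry`). BSD is not proved by any of this.

Setting = `…TowerDescent`: a profinite group `G`, `κ₀ : G → ℤ_p` continuous with exact index (`κ₀ δ₁ = p^c`), `H = ker κ₀`, the
layer `G_n = κ₀⁻¹(p^{c+n}ℤ_p)` (characterised by `hGn`), a discrete `p`-primary `G`-module `A` with open stabilisers. The tree's
`twoSided_count_layer` bounds `S(n,k) = {y ∈ H¹(H, A) | p^k y = 0, conj_{δ₁^{p^n}} y = y}` by `H¹(G_n, A)[p^k]` under the instance
«`A^H` finite» (through `#ker(res : H¹(G_n,A) → H¹(H,A)) ≤ #A^H`). At a TAME place of a `ℤ_p`-tower `A^H = E(K_{∞,w})[p^∞]` may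
be infinite; here the same inequality is proved under «`A^{G_n}` finite and `A[p]` finite»: the kernel `A^H/(γ_n⁻¹ − 1)A^H`
(`ProcyclicDescent.kerResEquiv`) is finite because `A^H` is cofinitely generated and `γ_n⁻¹ − 1` has finite kernel `⊆ A^{G_n}` on it
(the lead's `…CofiniteDivisiblePart.natCard_quotient_range_le_of_finite_ker`; an element fixed by `ker κ_n` and by `γ_n` is fixed by
the profinite `G_n`, by density of `ℕ·1` in `ℤ_p`).

* `smul_eq_self_of_apply_eq_one` — fixed by `ker κ` and by `γ` (`κ γ = 1`) ⇒ fixed by every `g` (profinite `G`, open stabiliser);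
* `finite_ker_resOfLe_of_finite_layerFixed` — `ker(res : H¹(G_n, A) → H¹(H, A))` is finite;
* `finite_and_natCard_pTorsion_pow_conj_fixed_le` — `S(n,k)` finite and `#S(n,k) ≤ #H¹(G_n, A)[p^k]`.

References: [GreenbergLNM1716] §3 Lemma 3.3 (p. 87); [SerreGaloisCohomology1997] I §2.6 (b), XIII §1; [Washington1997] §13.1.
-/

set_option autoImplicit false
-- the Theorems namespace of this sub repeats the summit name by design (D-0017 nested layout)
set_option linter.dupNamespace false

noncomputable section

open scoped Classical

open Function
open Literature.NumberTheory.EllipticCurves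
  Summit.BirchSwinnertonDyer.Rank1Residual.X11b Summit.BirchSwinnertonDyer.Rank1Residual.X11b.ProcyclicDescent
  Summit.BirchSwinnertonDyer.BirchSwinnertonDyer.Theorems.UniversalToricDescentTowerDescent

universe u

namespace Summit.BirchSwinnertonDyer.BirchSwinnertonDyer.Theorems.UniversalToricDescentLayerDescentFiniteKernel

/-! ### §1 Fixed by `ker κ` and by `γ` ⇒ fixed by the profinite group -/

section Density

variable {G : Type u} [Group G] [TopologicalSpace G] [IsTopologicalGroup G] [CompactSpace G]
variable {A : Type u} [AddCommGroup A] [DistribMulAction G A]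
variable {p : ℕ} [Fact p.Prime] (κ : G →ₜ* Multiplicative ℤ_[p]) {γ : G} (hγ : κ γ = Multiplicative.ofAdd 1)

include hγ in
/-- **Fixed by `ker κ` and by `γ` ⇒ fixed by `G`** (`G` compact, `κ : G → ℤ_p` continuous with `κ γ = 1`, the stabiliser of `a`
open): the stabiliser is an open, hence closed and compact, subgroup containing `ker κ`; its image in `ℤ_p` is closed and contains
`ℕ · 1`, which is dense (`PadicInt.denseRange_natCast`), so it is all of `ℤ_p`. [cite: Washington1997, §13.1] -/
theorem smul_eq_self_of_apply_eq_one (a : A) (ha : IsOpen {g : G | g • a = a}) (hH : ∀ h : G, κ h = 1 → h • a = a)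
    (hγa : γ • a = a) (g : G) : g • a = a := by
  -- the stabiliser as a subgroup, open hence closed
  let S : Subgroup G := MulAction.stabilizer G a
  have hSmem : ∀ x : G, x ∈ S ↔ x • a = a := fun x ↦ MulAction.mem_stabilizer_iff
  have hSopen : IsOpen (S : Set G) := by
    have e : (S : Set G) = {g : G | g • a = a} := Set.ext fun x ↦ hSmem x
    rw [e]; exact ha
  have hSclosed : IsClosed (S : Set G) := S.isClosed_of_isOpen hSopen
  -- the additive character and the closed image of the stabiliser
  let f : G → ℤ_[p] := fun x ↦ (κ x).toAdd
  have hf : Continuous f := continuous_toAdd.comp κ.continuous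
  have hTclosed : IsClosed (f '' (S : Set G)) := (hSclosed.isCompact.image hf).isClosed
  have hnat : Set.range (Nat.cast : ℕ → ℤ_[p]) ⊆ f '' (S : Set G) := by
    rintro _ ⟨m, rfl⟩
    refine ⟨γ ^ m, ?_, ?_⟩
    · rw [SetLike.mem_coe, hSmem]
      induction m with
      | zero => rw [pow_zero, one_smul]
      | succ m ih => rw [pow_succ, mul_smul, hγa, ih]
    · change (κ (γ ^ m)).toAdd = (m : ℤ_[p])
      rw [map_pow, hγ, ← ofAdd_nsmul, toAdd_ofAdd, nsmul_eq_mul, mul_one]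
  have hT : f '' (S : Set G) = Set.univ := by
    apply Set.eq_univ_of_univ_subset
    rw [← (PadicInt.denseRange_natCast (p := p)).closure_range]
    exact closure_minimal hnat hTclosed
  -- `κ g = κ s` for some `s ∈ S`, so `g = s · (s⁻¹ g)` with `s⁻¹ g ∈ ker κ`
  obtain ⟨s, hs, hsg⟩ : f g ∈ f '' (S : Set G) := by rw [hT]; exact Set.mem_univ _
  have hker : κ (s⁻¹ * g) = 1 := by
    rw [map_mul, map_inv, inv_mul_eq_one]
    exact Multiplicative.toAdd.injective hsg
  have hsa : s • a = a := (hSmem s).mp hs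
  calc g • a = (s * (s⁻¹ * g)) • a := by rw [mul_inv_cancel_left]
    _ = s • (s⁻¹ * g) • a := mul_smul _ _ _
    _ = a := by rw [hH _ hker, hsa]

end Density

/-! ### §2 The kernel of restriction at a layer is finite when the layer invariants are -/

section Layer

variable {G : Type u} [Group G] [TopologicalSpace G] [IsTopologicalGroup G] [CompactSpace G] [T2Space G]
  [TotallyDisconnectedSpace G]
variable {A : Type u} [AddCommGroup A] [DistribMulAction G A] [TopologicalSpace A] [DiscreteTopology A]
variable {p : ℕ} [Fact p.Prime] (κ₀ : G →ₜ* Multiplicative ℤ_[p])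
variable {c : ℕ} {δ₁ : G} (hδ₁ : (κ₀ δ₁).toAdd = (p : ℤ_[p]) ^ c)
variable {Gn : Subgroup G} {n : ℕ} (hGn : ∀ g : G, g ∈ Gn ↔ (p : ℤ_[p]) ^ (c + n) ∣ (κ₀ g).toAdd)

include hδ₁ hGn in
/-- **`ker(res : H¹(G_n, A) → H¹(H, A))` is finite when `A^{G_n}` and `A[p]` are** (`H = ker κ₀`, `A` discrete `p`-primary with
open stabilisers): the kernel is `A^H/(γ_n⁻¹ − 1)A^H` for the rescaled character `κ_n : G_n ↠ ℤ_p`, `γ_n = δ₁^{p^n}`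
(`ProcyclicDescent.kerResEquiv`); `A^H` is cofinitely generated and `γ_n⁻¹ − 1` has finite kernel on it (an element fixed by `ker κ_n`
and `γ_n` is fixed by `G_n`, §1), so the cokernel is finite (`…CofiniteDivisiblePart.natCard_quotient_range_le_of_finite_ker`).
[cite: GreenbergLNM1716, §3 proof of Lemma 3.3 (p. 87)] [cite: SerreGaloisCohomology1997, XIII §1] -/
theorem finite_ker_resOfLe_of_finite_layerFixed (hA : ∀ a : A, IsOpen {g : G | g • a = a})
    (hAt : Literature.NumberTheory.GaloisRepresentations.IsPrimaryTorsion p A) (hGc : IsClosed (Gn : Set G))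
    (hAp : Set.Finite {a : A | p • a = 0}) [Finite {a : A // ∀ g : G, g ∈ Gn → g • a = a}] :
    Finite (resOfLe A (kerK_le_layer κ₀ hGn)).ker := by
  have hp : p.Prime := Fact.out
  haveI : CompactSpace Gn := isCompact_iff_compactSpace.mp hGc.isCompact
  have hH : kerK κ₀ ≤ Gn := kerK_le_layer κ₀ hGn
  have hAn : ∀ a : A, IsOpen {g : Gn | g • a = a} := fun a ↦ (hA a).preimage continuous_subtype_val
  -- the rescaled character of `G_n`
  have hdiv : ∀ g : Gn, (p : ℤ_[p]) ^ (c + n) ∣ (κ₀.comp (subgroupIncl Gn) g).toAdd := fun g ↦ dvd_of_mem_layer κ₀ hGn g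
  let γn : Gn := ⟨δ₁ ^ p ^ n, by simpa only [mul_one] using pow_pow_mul_mem_layer κ₀ hδ₁ hGn 1⟩
  have hγn : (κ₀.comp (subgroupIncl Gn) γn).toAdd = (p : ℤ_[p]) ^ (c + n) := toAdd_apply_pow (n := n) κ₀ hδ₁
  have hsurj := ProcyclicDescent.rescale_surjective (κ₀.comp (subgroupIncl Gn)) (c + n) hdiv γn hγn
  have hone := ProcyclicDescent.rescale_eq_one (κ₀.comp (subgroupIncl Gn)) (c + n) hdiv γn hγn
  have hker : kerK (ProcyclicDescent.rescale (κ₀.comp (subgroupIncl Gn)) (c + n) hdiv) = kerK (κ₀.comp (subgroupIncl Gn)) :=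
    ProcyclicDescent.kerK_rescale (κ₀.comp (subgroupIncl Gn)) (c + n) hdiv
  -- the two kernels coincide (verbatim from `…TowerDescent.natCard_ker_resOfLe_le`)
  obtain ⟨τ, -, hτr⟩ := exists_transport (A := A) κ₀ hH
  have hkers : (resOfLe A hH).ker =
      (ResKernel.resSubgroup (kerK (ProcyclicDescent.rescale (κ₀.comp (subgroupIncl Gn)) (c + n) hdiv)) A).ker := by
    ext z
    rw [AddMonoidHom.mem_ker, AddMonoidHom.mem_ker, ← ProcyclicDescent.resOfLe_comp_resSubgroup (A := A) hker.le,
      AddMonoidHom.comp_apply]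
    constructor
    · intro h
      rw [← hτr, h, map_zero, map_zero]
    · intro h
      have h' := congrArg (resOfLe A hker.ge) h
      rw [ProcyclicDescent.resOfLe_resOfLe_of_eq (A := A) hker, map_zero, ← hτr] at h'
      exact τ.injective (by rw [h', map_zero])
  -- `B = A^{ker κ_n}` (a type), `φ = γ_n⁻¹ − 1`
  let κn := ProcyclicDescent.rescale (κ₀.comp (subgroupIncl Gn)) (c + n) hdiv
  let B : Type u := ProcyclicDescent.fixedSubgroup (A := A) (kerK κn)
  let φ : B →+ B := ProcyclicDescent.subOneFixed (A := A) (kerK κn) γn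
  -- `B` is `p`-primary with finite `p`-torsion
  have hB : ∀ b : B, ∃ m : ℕ, p ^ m • b = 0 := fun b ↦ by
    obtain ⟨m, hm⟩ := hAt (b : A)
    exact ⟨m, Subtype.ext (by rw [AddSubgroupClass.coe_nsmul, hm]; rfl)⟩
  have hfinB : Set.Finite {b : B | p • b = 0} := by
    haveI : Finite {a : A // p • a = 0} := hAp.to_subtype
    have hfin : Finite {b : B // p • b = 0} := by
      refine Finite.of_injective (fun b ↦ (⟨(b.1 : A), ?_⟩ : {a : A // p • a = 0})) ?_
      · have e := congrArg (fun x : B ↦ (x : A)) b.2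
        simp only [ZeroMemClass.coe_zero] at e
        exact e
      · intro b₁ b₂ h
        exact Subtype.ext (Subtype.ext (congrArg Subtype.val h :))
    exact Set.finite_coe_iff.mp hfin
  obtain ⟨D, k₀, hDmem, hDdiv, -, hBD⟩ := UniversalToricDescentCofiniteDivisiblePart.exists_divisiblePart (B := B) hB hfinB
  haveI := hBD
  -- `ker φ` injects into `A^{G_n}`
  have hkerφ : Set.Finite (φ.ker : Set B) := by
    have hfin : Finite φ.ker := by
      refine Finite.of_injective (fun b : φ.ker ↦ (⟨((b : B) : A), fun g hg ↦ ?_⟩ : {a : A // ∀ g : G, g ∈ Gn → g • a = a})) ?_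
      · -- `γ_n⁻¹ • b = b` and `b` is fixed by `ker κ_n`, hence by all of `G_n`
        have hb0 : φ (b : B) = 0 := (AddMonoidHom.mem_ker).mp b.2
        have hb1 : γn⁻¹ • ((b : B) : A) - ((b : B) : A) = 0 :=
          congrArg (fun x : B ↦ (x : A)) hb0
        have hb2 : γn • ((b : B) : A) = ((b : B) : A) := by
          rw [sub_eq_zero] at hb1
          conv_lhs => rw [← hb1]
          rw [smul_inv_smul]
        have hb3 : ∀ h : Gn, κn h = 1 → h • ((b : B) : A) = ((b : B) : A) := fun h hh ↦
          (ProcyclicDescent.mem_fixedSubgroup_iff (kerK κn) _).mp (b : B).2 ⟨h, hh⟩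
        have key := smul_eq_self_of_apply_eq_one κn hone ((b : B) : A) (hAn _) hb3 hb2 ⟨g, hg⟩
        exact key
      · intro b₁ b₂ h
        exact Subtype.ext (Subtype.ext (congrArg Subtype.val h :))
    exact Set.finite_coe_iff.mpr hfin
  have hfinQ : Finite (B ⧸ φ.range) :=
    (UniversalToricDescentCofiniteDivisiblePart.natCard_quotient_range_le_of_finite_ker hp hB hfinB hDmem hDdiv φ hkerφ).1
  rw [hkers]
  exact Finite.of_equiv _ (ProcyclicDescent.kerResEquiv hAn κn hsurj hone hAt).toEquiv

include hδ₁ hGn in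
/-- **The descent count at a layer with finite layer invariants (brick (D) of R3):** for
`S(n,k) = {y ∈ H¹(H, A) | p^k y = 0, conj_{δ₁^{p^n}} y = y}` (`H = ker κ₀`), `S(n,k)` is finite and `#S(n,k) ≤ #H¹(G_n, A)[p^k]`,
granted `G_n` closed, `A^{G_n}`, `A[p]` and `H¹(G_n, A)[p^k]` finite, and the uniform stabiliser property (A2) of the classes of
`H¹(H, A)`. (`res : H¹(G_n, A) → H¹(H, A)^{G_n}` is onto with finite kernel; count along `res`, `…TowerDescent.finite_and_le_and_le_of_res`.)
[cite: GreenbergLNM1716, §3 Lemma 3.3] [cite: SerreGaloisCohomology1997, I §2.6 (b)] -/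
theorem finite_and_natCard_pTorsion_pow_conj_fixed_le (hA : ∀ a : A, IsOpen {g : G | g • a = a})
    (hAt : Literature.NumberTheory.GaloisRepresentations.IsPrimaryTorsion p A) (hGc : IsClosed (Gn : Set G))
    (hAp : Set.Finite {a : A | p • a = 0})
    (hfix : ∀ y : subgroupH1 (kerK κ₀) A, ∃ t : ℕ, ∀ g : G, (p : ℤ_[p]) ^ t ∣ (κ₀ g).toAdd → conjH1 (kerK κ₀) A g y = y)
    [Finite {a : A // ∀ g : G, g ∈ Gn → g • a = a}] (k : ℕ) [Finite {z : subgroupH1 Gn A // p ^ k • z = 0}] :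
    Set.Finite {y : subgroupH1 (kerK κ₀) A | p ^ k • y = 0 ∧ conjH1 (kerK κ₀) A (δ₁ ^ p ^ n) y = y} ∧
    Nat.card {y : subgroupH1 (kerK κ₀) A // p ^ k • y = 0 ∧ conjH1 (kerK κ₀) A (δ₁ ^ p ^ n) y = y} ≤
      Nat.card {z : subgroupH1 Gn A // p ^ k • z = 0} := by
  haveI : Gn.Normal := normal_layer κ₀ hGn
  have hH : kerK κ₀ ≤ Gn := kerK_le_layer κ₀ hGn
  -- the subgroup `S(n,k)` of `p^k`-torsion `G_n`-invariant classes
  let S : AddSubgroup (subgroupH1 (kerK κ₀) A) :=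
    { carrier := {y | p ^ k • y = 0 ∧ ∀ g : G, g ∈ Gn → conjH1 (kerK κ₀) A g y = y}
      zero_mem' := ⟨smul_zero _, fun g _ ↦ map_zero _⟩
      add_mem' := fun {a b} ha hb ↦ ⟨by rw [smul_add, ha.1, hb.1, add_zero], fun g hg ↦ by rw [map_add, ha.2 g hg, hb.2 g hg]⟩
      neg_mem' := fun {a} ha ↦ ⟨by rw [smul_neg, ha.1, neg_zero], fun g hg ↦ by rw [map_neg, ha.2 g hg]⟩ }
  have hmemS : ∀ y, y ∈ S ↔ p ^ k • y = 0 ∧ conjH1 (kerK κ₀) A (δ₁ ^ p ^ n) y = y := fun y ↦ by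
    rw [conjH1_pow_eq_self_iff_forall_layer κ₀ hδ₁ hGn y (hfix y)]
    rfl
  have eS : S ≃ {y : subgroupH1 (kerK κ₀) A // p ^ k • y = 0 ∧ conjH1 (kerK κ₀) A (δ₁ ^ p ^ n) y = y} :=
    Equiv.subtypeEquivRight hmemS
  have eX : (nsmulAddMonoidHom (α := subgroupH1 Gn A) (p ^ k)).ker ≃ {z : subgroupH1 Gn A // p ^ k • z = 0} :=
    Equiv.subtypeEquivRight fun z ↦ by rw [AddMonoidHom.mem_ker, nsmulAddMonoidHom_apply]
  haveI : Finite (nsmulAddMonoidHom (α := subgroupH1 Gn A) (p ^ k)).ker := Finite.of_equiv _ eX.symm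
  -- the restriction has finite kernel
  haveI : Finite (resOfLe A hH).ker := finite_ker_resOfLe_of_finite_layerFixed κ₀ hδ₁ hGn hA hAt hGc hAp
  obtain ⟨hSfin, -, h2⟩ := finite_and_le_and_le_of_res (resOfLe A hH) S (p ^ k) (fun y hy ↦ hy.1)
    (fun y hy ↦ exists_resOfLe_eq_of_forall κ₀ hA hAt hGc hH y hy.2)
    (fun z hz ↦ ⟨by rw [← map_nsmul, hz, map_zero], fun g hg ↦ by
      rw [← AddMonoidHom.comp_apply, ← resOfLe_comp_conjH1_holds (M := A) hH g, AddMonoidHom.comp_apply,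
        conjH1_of_mem_holds Gn A hg, AddMonoidHom.id_apply]⟩)
  refine ⟨?_, ?_⟩
  · exact Set.finite_coe_iff.mp (Finite.of_equiv _ eS)
  · rw [← Nat.card_congr eX, ← Nat.card_congr eS]
    exact h2

end Layer

end Summit.BirchSwinnertonDyer.BirchSwinnertonDyer.Theorems.UniversalToricDescentLayerDescentFiniteKernel

end
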